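/-
Copyright: statement-level skeleton of a published paper (lit-balaban cell, Phase-2 proof seat p13, gen 12). No proof
claims beyond what the kernel checks below.
-/
import Literature.MathematicalPhysics.QuantumFieldTheory.BalabanImbrieJaffe1984to88.BIJ88TruncatedPair306
import Literature.MathematicalPhysics.QuantumFieldTheory.BalabanImbrieJaffe1984to88.BIJ88SDerivative305
import Literature.MathematicalPhysics.QuantumFieldTheory.BalabanImbrieJaffe1984to88.BIJ88FTCExpansion305
import Literature.Probability.LatticeModels.UrsellInversion

/-!
# `BalabanImbrieJaffe1984to88.BIJ88PairingDisplay305` — T. Bałaban, J. Imbrie, A. Jaffe, *Effective action and cluster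
properties of the abelian Higgs model*, Commun. Math. Phys. **114** (1988) 257–315 [BalabanImbrieJaffe1988], §5.13
p. 305 [PDF 49], the display introduced by *"The result is"* — the PAIRING FORM of the cluster expansion, i.e. the
pre-integration-by-parts form of **(5.13.3)**:

**"Subsequent derivatives either hit factors s_j already pulled down or bring new terms down with new truncations. After
all derivatives are performed, we set the remaining s_j to zero, so only terms with no s_j multiplying them survive. The
result is  ⟨Π_{i∈I} f(□_i)⟩_1 = Σ_{Γ⊂I} ∫ds_Γ Σ_{pairings p={p_γ} of Γ, p_γ={i_γ,j_γ}} ⟨Π_{γ=1}^{|Γ|/2}[⟨□_{i_γ}Φ,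
Δ□_{j_γ}Φ⟩;] Π_{i∈I} f(□_i)⟩_{s_Γ}"** (pages re-read as images: `lit-balaban-ref-1/renders/cmp114/original-p049-x2.png`,
`…-p050-x2.png`).

THIS FILE: (§1) the printed right-hand side TYPED in the tree's vocabulary for the finite-dimensional Gaussian model of
record (p13 g6 / p02 / p25: `dμ_s ∝ e^{−½⟨Φ,Δ_sΦ⟩}e^{⟨Φ,ℱ⟩}dΦ`, `Δ_s = BIJ88DirichletForms305.interpForm`): *pairings* =
set partitions of `Γ` into blocks of two cubes (`LatticeModels.setPartitions`), the vertex of a block `{i,j}` =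
`⟨□_iΦ, Δ_print□_jΦ⟩` (`Δ_print = −Δ`, the tree's sign convention), *"[ ;]"* = truncation = the Ursell function
(`LatticeModels.ursellOf`) of the normalized moments of the vertices and the observable, `Σ_{Γ⊂I}∫ds_Γ` =
`BIJ88FTCExpansion305.expansionSum`/`iterInt`; and (§2–§5) a **KERNEL WITNESS THAT THE DISPLAY FAILS AS PRINTED** in the
smallest instance of the model: two cubes with one real field component each, `Δ_print = −[[2,−1],[−1,2]]`,
`f(□₀) = Φ₀`, `f(□₁) = Φ₁`, `ℱ = 0`.  With `t = s₀s₁` the covariance is `C_s = [[2,t],[t,2]]/(4−t²)`, so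
`⟨Φ₀Φ₁⟩_s = t/(4−t²)` and the printed integrand for `Γ = {0,1}` (the one pairing `{{0,1}}`) is
`⟨[⟨□₀Φ,Δ_print□₁Φ⟩;]Φ₀Φ₁⟩_s = ⟨Φ₀²Φ₁²⟩_s − ⟨Φ₀Φ₁⟩_s² = (4+t²)/(4−t²)²`; the printed right-hand side is
`⟨Φ₀Φ₁⟩_0 + 0 + 0 + ∫₀¹∫₀¹ (4+s₀²s₁²)/(4−s₀²s₁²)² ds₁ds₀ = ∫₀¹ ds₀/(4−s₀²) = (log 3)/4 ≈ 0.2747`, whereas the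
left-hand side is `⟨Φ₀Φ₁⟩_1 = 1/3` (**`pairingDisplay_fails`**).

WHY (located on the page, p. 305 lines above the display): for `j ∈ Γ` the factor `s_j` is NOT set to zero — it is
integrated over `[0,1]` (*"Here s_Γ specifies s_i = 0 for i ∉ Γ"*) —, so the terms in which `∂/∂s_j` *"bring[s] new terms
down"* while an earlier pulled-down factor `s_j` survives do not drop out.  At `|Γ| = 2` the mixed partial of the
expectation is `∂_j∂_i⟨H⟩_s = ⟨[V_{ij};]H⟩_s + s_is_j⟨[V_{ij};][V_{ji};]H⟩_s` (third truncation); the display keeps the first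
term.  In the instance: `∂₁∂₀⟨Φ₀Φ₁⟩_s = g′(t) + t·g″(t)` with `g(t) = t/(4−t²)`, the display keeps `g′(t)` (and indeed
`∫₀¹∫₀¹[g′(s₀s₁) + s₀s₁g″(s₀s₁)]ds₁ds₀ = ∫₀¹ g′(s₀)ds₀ = g(1) − g(0) = 1/3`: the omitted term accounts exactly for the
difference `1/3 − (log 3)/4`).  The fundamental-theorem-of-calculus identity itself (p02
`BIJ88FTCExpansion305.ftc_expansion_univ`, p25 `ftc_expansion_gauss`) is not in question; what fails is the evaluation of
`∂/∂s_Γ⟨Πf(□_i)⟩_{s_Γ}` by perfect matchings alone.  Since (5.13.3) is the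
integration by parts of this display (walks `ω = (i₁,…,i_{2m})` visiting each site of a block once), (5.13.3) inherits the
omission; the omitted terms carry extra vertices and extra factors `s ∈ [0,1]` (walks revisiting cubes) — an erratum of
derivation for the row owner's register (r16, C2 §5; GAPS.md text proposed with this file), not a claim about the
method's estimates.

statement-level skeleton of published theorems with citation tags; proofs where landed; nothing here is a claim
about the Yang–Mills mass gap

PDF held: `paper:balaban1988-cmp114-bij-abelian-higgs-effective-action` (journal page = PDF page + 256).

CITATION HEADER (lean-in-tree rule).  lit-balaban cell (HOME `run/shared/lean/pub/lit-balaban/`), Phase 2, seat p13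
gen 12; row **C2.Eq5.13.3-5.13.4** of `HOME/lit-balaban-r16/ROWS-C2-part2.md` (owner r16, referee ref-5), answering the
owner's flip condition of 2026-08-22T03:52:40Z ("(5.13.3) at every order |Γ|") with a located failure at `|Γ| = 2`.
USED BY NAME, nothing restated: `…BIJ88TruncatedPair306.pair_vacuum` (p13 g6, p257103);
`…BIJ88IntegrationByParts305.ibp_source_of_integrable`, `integrable_fieldProd_tilt`, `weight_mul_source` (p13 g6, p256140);
`…BIJ88SDerivative305.integral_weight_mul_source_pos` (p13 g6, p256629); `…BIJ88DirichletForms305.interpForm(_apply,_posDef)`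
(p02, p252603); `…BIJ88DirichletDeriv305.blockPair` (p02, p253961); `…BIJ88FTCExpansion305.expansionSum`/`iterInt`/`onePt`
(p02, p253811); `Literature.Probability.LatticeModels.setPartitions`/`ursellOf(_singleton,_pair)`.

## What is proved (0 `sorry`, standard axioms; `decide` only on set partitions of subsets of `Fin 2`)

* §1 (general model `blk : α → I`, `Δ`, `ℱ`, observable `H`): `expect`, `pairVertex`, `pairings`, `insertion`, `moment`,
  `truncTerm`, `pairingD` (the printed replacement of `∂/∂s_Γ⟨H⟩_{s_Γ}`); `pairings_empty`, `pairings_singleton`,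
  `mem_pairings_pair`/`pairings_pair`, `moment_empty`, `truncTerm_empty` (`= ⟨H⟩_s`), `truncTerm_single`
  (`= ⟨V_BH⟩_s − ⟨V_B⟩_s⟨H⟩_s`), `pairingD_empty`, `pairingD_singleton` (`= 0`), `pairingD_pair`.
* §2 the two-cube instance `cube2 = id`, `delta2 = [[2,−1],[−1,2]]` (`delta2_quadForm`, `delta2_posDef`), `obs2 Φ = Φ₀Φ₁`,
  `prec2 t = [[2,−t],[−t,2]]`; `interpForm_delta2` (`Δ_s = prec2 (s₀s₁)`), `prec2_posDef` (`t² < 4`), `inv_prec2`,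
  `cov_col0`/`cov_col1` (`C_s = [[2,t],[t,2]]/(4−t²)`).
* §3 moments (`t² < 4`, no linear term): `Z_pos`, `integrable_prod`/`integrable_mono2/3/4` (moments exist), `moment2`
  (`∫Φ_aΦ_b dμ = C_{ab}·Z`, p13 g6 `pair_vacuum`), `moment11` (`= t/(4−t²)·Z`), `moment_sq1` (`= 2/(4−t²)·Z`),
  `hasFDerivAt_cubic`, **`moment22`** (`∫Φ₀²Φ₁²dμ = (4+2t²)/(4−t²)²·Z`: one integration by parts, p13 g6
  `ibp_source_of_integrable`, + two vacuum pairs); `expect_obs2` (`⟨Φ₀Φ₁⟩_s = s₀s₁/(4−(s₀s₁)²)`), `blockPair_delta2`,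
  `pairVertex_01` (`V_{01} = Φ₀Φ₁`), **`pairingD_obs2_pair`** (the printed `Γ = {0,1}` integrand `= (4+t²)/(4−t²)²`).
* §4 the integrals and the witness: `inner_integral` (`∫₀¹(4+a²u²)/(4−a²u²)²du = 1/(4−a²)`, `a² ≤ 1`), `outer_integral`
  (`∫₀¹da/(4−a²) = (log 3)/4`), `expect_obs2_one` (`⟨Φ₀Φ₁⟩_1 = 1/3`), `expect_obs2_zero` (`⟨Φ₀Φ₁⟩_0 = 0`), `onePt_two`,
  **`expansionSum_pairingD_obs2`** (the printed right-hand side `= (log 3)/4`), private `log_three_lt` (`log 3 < 4/3`),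
  **`pairingDisplay_fails`**: `⟨Φ₀Φ₁⟩_{(1,1)} ≠ Σ_{Γ⊂{0,1}}∫ds_Γ Σ_{pairings of Γ}⟨Π[V;]Φ₀Φ₁⟩_{s_Γ}`.
HONEST SCOPE.  One real field component per cube, no constraint `δ_{Ax}`, polynomial (unbounded) cube factors `f(□_i) = Φ_i`
— the class of p25's accepted witness `BIJ88PolymerRep5134GaussWitness` (moments); the truncation "[ ;]" of several
insertions read as the joint cumulant (Ursell function), as in the row owner's reading of (5.14.2); the general corrected
second-order identity for bounded observables is filed separately.  NOT summit progress; NOT continuum; NOT Clay.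
Imports as listed; modifies nothing.
-/

noncomputable section

namespace Literature.MathematicalPhysics.QuantumFieldTheory.BalabanImbrieJaffe1984to88.BIJ88PairingDisplay305

open MeasureTheory Matrix Finset Function
open scoped BigOperators
open Literature.Probability.LatticeModels (setPartitions IsSetPartition mem_setPartitions setPartitions_empty
  setPartitions_singleton isSetPartition_singleton ursellOf ursellOf_singleton ursellOf_pair)
open Literature.MathematicalPhysics.QuantumFieldTheory.Balaban1983to89
open B2Eq228Conditioning (weight source)
open BIJ88DirichletForms305 (interpForm interpForm_apply interpForm_posDef)
open BIJ88DirichletDeriv305 (blockPair)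
open BIJ88IntegrationByParts305 (ibp_source_of_integrable integrable_fieldProd_tilt weight_mul_source)
open BIJ88TruncatedPair306 (pair_vacuum)
open BIJ88SDerivative305 (integral_weight_mul_source_pos)
open BIJ88FTCExpansion305 (iterInt expansionSum onePt)

/-! ## §1  The printed objects in the finite-dimensional model of record -/

section Pairings

variable {I : Type} [DecidableEq I]

/-- *"pairings p = {p_γ} of Γ, p_γ = {i_γ, j_γ}"*: the set partitions of `Γ` all of whose blocks have two elements.
[cite: BalabanImbrieJaffe1988, §5.13 p.305] -/
def pairings (Γ : Finset I) : Finset (Finset (Finset I)) :=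
  (setPartitions Γ).filter fun p => ∀ B ∈ p, B.card = 2

/-- The empty set has exactly the empty pairing. [cite: BalabanImbrieJaffe1988, §5.13 p.305] -/
theorem pairings_empty : pairings (∅ : Finset I) = {∅} := by
  rw [pairings, setPartitions_empty]
  ext p
  simp only [mem_filter, mem_singleton, and_iff_left_iff_imp]
  rintro rfl
  simp

/-- A single cube has no pairing (`|Γ|` odd). [cite: BalabanImbrieJaffe1988, §5.13 p.305] -/
theorem pairings_singleton (i : I) : pairings ({i} : Finset I) = ∅ := by
  rw [pairings, setPartitions_singleton]
  ext p
  simp only [mem_filter, mem_singleton, Finset.notMem_empty, iff_false, not_and]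
  rintro rfl h
  have := h {i} (mem_singleton_self _)
  simp at this

/-- Two cubes `i ≠ j` have exactly the pairing `{{i,j}}`. [cite: BalabanImbrieJaffe1988, §5.13 p.305] -/
theorem mem_pairings_pair {i j : I} (hij : i ≠ j) (p : Finset (Finset I)) :
    p ∈ pairings ({i, j} : Finset I) ↔ p = {{i, j}} := by
  have hcard : ({i, j} : Finset I).card = 2 := card_pair hij
  constructor
  · intro hp
    rw [pairings, mem_filter, mem_setPartitions] at hp
    obtain ⟨⟨hsub, hne, hcov, _⟩, h2⟩ := hp
    -- every block is a 2-subset of `{i,j}`, hence `{i,j}` itself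
    have hB : ∀ B ∈ p, B = {i, j} := fun B hB =>
      Finset.eq_of_subset_of_card_le (hsub B hB) (by rw [hcard, h2 B hB])
    obtain ⟨B₀, hB₀, -⟩ := hcov i (mem_insert_self i {j})
    ext B
    simp only [mem_singleton]
    exact ⟨fun hB' => hB B hB', fun h => by rw [h, ← hB B₀ hB₀]; exact hB₀⟩
  · rintro rfl
    rw [pairings, mem_filter, mem_setPartitions]
    exact ⟨isSetPartition_singleton (insert_nonempty i {j}), fun B hB => by rw [mem_singleton.1 hB, hcard]⟩

/-- `pairings {i,j} = {{{i,j}}}` for `i ≠ j`. [cite: BalabanImbrieJaffe1988, §5.13 p.305] -/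
theorem pairings_pair {i j : I} (hij : i ≠ j) : pairings ({i, j} : Finset I) = {{{i, j}}} := by
  ext p
  rw [mem_pairings_pair hij, mem_singleton]

end Pairings

section General

variable {α I : Type} [Fintype α] [DecidableEq α] [Fintype I] [DecidableEq I]
  (blk : α → I) (Δ : Matrix α α ℝ) (ℱ : α → ℝ)

/-- `⟨G⟩_s` — the normalized expectation in the measure `e^{−½⟨Φ,Δ_sΦ⟩}e^{⟨Φ,ℱ⟩}dΦ / Z_s`, `Δ_s = interpForm blk Δ s`
(the tree feeds `Δ := −Δ_print`, positive definite); the ratio of the two integrals of p13 g6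
`BIJ88SDerivative305.hasDerivAt_expectation_interp` (all fields integrated; p25's region expectations
`BIJ88PolymerRep5134Gauss.expect` restrict to the fields of a region `X` through a subtype, not needed here).
[cite: BalabanImbrieJaffe1988, §5.13 p.305] -/
def expect (G : (α → ℝ) → ℝ) (s : I → ℝ) : ℝ :=
  (∫ φ : α → ℝ, G φ * (weight (interpForm blk Δ s) φ * source ℱ φ))
    / ∫ φ : α → ℝ, weight (interpForm blk Δ s) φ * source ℱ φ

/-- The printed vertex of a block `B = {i,j}` of a pairing: `⟨□_iΦ, Δ_print□_jΦ⟩ = −⟨□_iΦ, Δ□_jΦ⟩` (tree sign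
`Δ = −Δ_print`), written symmetrically over the block as `−½Σ_{i∈B}Σ_{j∈B∖i}⟨□_iΦ,Δ□_jΦ⟩` (for symmetric `Δ` and
`B = {i,j}` this is `−⟨□_iΦ,Δ□_jΦ⟩`; in the instance `pairVertex_01`). [cite: BalabanImbrieJaffe1988, §5.13 p.305] -/
def pairVertex (B : Finset I) (φ : α → ℝ) : ℝ :=
  -(1/2 : ℝ) * ∑ i ∈ B, ∑ j ∈ B.erase i, blockPair blk Δ φ i j

/-- The insertions of a truncated expectation `⟨Π_γ[V_γ;] H⟩`: `none ↦ H` (the observable `Π_{i∈I}f(□_i)`),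
`some B ↦ V_B` (the vertex of the block `B`). [cite: BalabanImbrieJaffe1988, §5.13 p.305] -/
def insertion (H : (α → ℝ) → ℝ) : Option (Finset I) → (α → ℝ) → ℝ
  | none => H
  | some B => pairVertex blk Δ B

/-- The normalized moments of the insertions: `J ↦ ⟨Π_{a∈J} X_a⟩_s`. [cite: BalabanImbrieJaffe1988, §5.13 p.305] -/
def moment (H : (α → ℝ) → ℝ) (s : I → ℝ) (J : Finset (Option (Finset I))) : ℝ :=
  expect blk Δ ℱ (fun φ => ∏ a ∈ J, insertion blk Δ H a φ) s

/-- **`⟨Π_{γ∈p}[V_γ;] H⟩_s`** — the truncated expectation of the vertices of the pairing `p` and the observable `H`: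
the Ursell function (joint cumulant, `LatticeModels.ursellOf`) of their normalized moments, evaluated on the index set
`{H} ∪ p`. [cite: BalabanImbrieJaffe1988, §5.13 p.305] -/
def truncTerm (H : (α → ℝ) → ℝ) (p : Finset (Finset I)) (s : I → ℝ) : ℝ :=
  ursellOf (moment blk Δ ℱ H s) (insert none (p.image some))

/-- **The printed evaluation of `∂/∂s_Γ ⟨H⟩_{s}`**: `Σ_{pairings p of Γ} ⟨Π_{γ∈p}[V_γ;] H⟩_s`.
[cite: BalabanImbrieJaffe1988, §5.13 p.305] -/
def pairingD (H : (α → ℝ) → ℝ) (Γ : Finset I) (s : I → ℝ) : ℝ :=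
  ∑ p ∈ pairings Γ, truncTerm blk Δ ℱ H p s

/-- With a positive definite precision the empty moment is `⟨1⟩_s = 1`. [cite: BalabanImbrieJaffe1988, §5.13 p.305] -/
theorem moment_empty (H : (α → ℝ) → ℝ) {s : I → ℝ} (hA : (interpForm blk Δ s).PosDef) :
    moment blk Δ ℱ H s ∅ = 1 := by
  have hZ := integral_weight_mul_source_pos hA ℱ
  simp only [moment, expect, prod_empty, one_mul]
  exact div_self hZ.ne'

/-- The empty pairing contributes the plain expectation: `⟨Π_{γ∈∅}[V_γ;] H⟩_s = ⟨H⟩_s`.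
[cite: BalabanImbrieJaffe1988, §5.13 p.305] -/
theorem truncTerm_empty (H : (α → ℝ) → ℝ) (s : I → ℝ) :
    truncTerm blk Δ ℱ H ∅ s = expect blk Δ ℱ H s := by
  simp only [truncTerm, image_empty, insert_empty_eq, ursellOf_singleton, moment, prod_singleton, insertion]

/-- One vertex: `⟨[V_B;] H⟩_s = ⟨V_BH⟩_s − ⟨V_B⟩_s⟨H⟩_s` (the covariance, `ursellOf_pair`).
[cite: BalabanImbrieJaffe1988, §5.13 p.305] -/
theorem truncTerm_single (H : (α → ℝ) → ℝ) (B : Finset I) {s : I → ℝ} (hA : (interpForm blk Δ s).PosDef) :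
    truncTerm blk Δ ℱ H {B} s
      = expect blk Δ ℱ (fun φ => H φ * pairVertex blk Δ B φ) s
        - expect blk Δ ℱ H s * expect blk Δ ℱ (pairVertex blk Δ B) s := by
  have hne : (none : Option (Finset I)) ≠ some B := (Option.some_ne_none B).symm
  rw [truncTerm, image_singleton, ursellOf_pair _ (moment_empty blk Δ ℱ H hA) hne]
  simp only [moment, prod_pair hne, prod_singleton, insertion]

/-- `Γ = ∅`: the printed term is `⟨H⟩_s`. [cite: BalabanImbrieJaffe1988, §5.13 p.305] -/
theorem pairingD_empty (H : (α → ℝ) → ℝ) (s : I → ℝ) : pairingD blk Δ ℱ H ∅ s = expect blk Δ ℱ H s := by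
  rw [pairingD, pairings_empty, sum_singleton, truncTerm_empty]

/-- `|Γ| = 1`: no pairing, the printed term is `0`. [cite: BalabanImbrieJaffe1988, §5.13 p.305] -/
theorem pairingD_singleton (H : (α → ℝ) → ℝ) (i : I) (s : I → ℝ) : pairingD blk Δ ℱ H {i} s = 0 := by
  rw [pairingD, pairings_singleton, sum_empty]

/-- `Γ = {i,j}`: the printed term is the single truncated pair `⟨[V_{ij};] H⟩_s`. [cite: BalabanImbrieJaffe1988, §5.13 p.305] -/
theorem pairingD_pair (H : (α → ℝ) → ℝ) {i j : I} (hij : i ≠ j) (s : I → ℝ) :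
    pairingD blk Δ ℱ H {i, j} s = truncTerm blk Δ ℱ H {{i, j}} s := by
  rw [pairingD, pairings_pair hij, sum_singleton]

end General

/-! ## §2  The two-cube instance -/

section TwoCubes

/-- Two cubes, one site each: the block map is the identity of `Fin 2`. [cite: BalabanImbrieJaffe1988, §5.13 p.305] -/
abbrev cube2 : Fin 2 → Fin 2 := id

/-- The form `Δ = [[2,−1],[−1,2]]` (tree sign; `Δ_print = −Δ` couples the two cubes with `+1`).
[cite: BalabanImbrieJaffe1988, §5.13 p.305] -/
def delta2 : Matrix (Fin 2) (Fin 2) ℝ := !![2, -1; -1, 2]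

/-- The observable `Π_{i∈I} f(□_i)` with `f(□₀) = Φ₀`, `f(□₁) = Φ₁`. [cite: BalabanImbrieJaffe1988, §5.13 p.305] -/
def obs2 (φ : Fin 2 → ℝ) : ℝ := φ 0 * φ 1

/-- `delta2` is symmetric. [cite: BalabanImbrieJaffe1988, §5.13 p.305] -/
theorem delta2_isHermitian : delta2.IsHermitian := by
  rw [Matrix.IsHermitian, Matrix.conjTranspose_eq_transpose_of_trivial]
  ext i j
  fin_cases i <;> fin_cases j <;> rfl

/-- `⟨x, delta2 x⟩ = x₀² + x₁² + (x₀ − x₁)²`. [cite: BalabanImbrieJaffe1988, §5.13 p.305] -/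
theorem delta2_quadForm (x : Fin 2 → ℝ) :
    x ⬝ᵥ (delta2 *ᵥ x) = x 0 ^ 2 + x 1 ^ 2 + (x 0 - x 1) ^ 2 := by
  simp only [delta2, dotProduct, mulVec, Fin.sum_univ_two, Matrix.of_apply, Matrix.cons_val', Matrix.cons_val_zero,
    Matrix.cons_val_one, Matrix.empty_val', Matrix.cons_val_fin_one]
  ring

/-- `delta2` is positive definite (*"To preserve positivity"*). [cite: BalabanImbrieJaffe1988, §5.13 p.305] -/
theorem delta2_posDef : delta2.PosDef := by
  refine Matrix.posDef_iff_dotProduct_mulVec.mpr ⟨delta2_isHermitian, fun x hx => ?_⟩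
  rw [star_trivial, delta2_quadForm]
  have h : x 0 ≠ 0 ∨ x 1 ≠ 0 := by
    by_contra hcon
    push Not at hcon
    apply hx
    funext i
    fin_cases i
    · exact hcon.1
    · exact hcon.2
  rcases h with h | h
  · have h0 : 0 < x 0 ^ 2 := by positivity
    nlinarith [sq_nonneg (x 1), sq_nonneg (x 0 - x 1)]
  · have h1 : 0 < x 1 ^ 2 := by positivity
    nlinarith [sq_nonneg (x 0), sq_nonneg (x 0 - x 1)]

/-- The interpolated precision as a function of `t = s₀s₁`: `[[2, −t], [−t, 2]]`. [cite: BalabanImbrieJaffe1988, §5.13 p.305] -/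
def prec2 (t : ℝ) : Matrix (Fin 2) (Fin 2) ℝ := !![2, -t; -t, 2]

/-- **`Δ_s = [[2, −s₀s₁], [−s₀s₁, 2]]`** (p. 305 *"□_iΔ_s□_{i′} = s_is_{i′}□_iΔ□_{i′}, i′ ≠ i, □_iΔ_s□_i = □_iΔ□_i"*).
[cite: BalabanImbrieJaffe1988, §5.13 p.305] -/
theorem interpForm_delta2 (s : Fin 2 → ℝ) : interpForm cube2 delta2 s = prec2 (s 0 * s 1) := by
  ext i j
  fin_cases i <;> fin_cases j <;> simp [interpForm_apply, delta2, prec2, mul_comm]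

/-- The interpolated precision is positive definite whenever `t² < 4`, `t = s₀s₁` (in particular on the unit square).
[cite: BalabanImbrieJaffe1988, §5.13 p.305] -/
theorem prec2_posDef {t : ℝ} (ht : t ^ 2 < 4) : (prec2 t).PosDef := by
  have hH : (prec2 t).IsHermitian := by
    rw [Matrix.IsHermitian, Matrix.conjTranspose_eq_transpose_of_trivial]
    ext i j
    fin_cases i <;> fin_cases j <;> rfl
  refine Matrix.posDef_iff_dotProduct_mulVec.mpr ⟨hH, fun x hx => ?_⟩
  have hq : x ⬝ᵥ (prec2 t *ᵥ x) = 2 * x 0 ^ 2 - 2 * t * (x 0 * x 1) + 2 * x 1 ^ 2 := by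
    simp only [prec2, dotProduct, mulVec, Fin.sum_univ_two, Matrix.of_apply, Matrix.cons_val', Matrix.cons_val_zero,
      Matrix.cons_val_one, Matrix.empty_val', Matrix.cons_val_fin_one]
    ring
  rw [star_trivial, hq]
  have h : x 0 ≠ 0 ∨ x 1 ≠ 0 := by
    by_contra hcon
    push Not at hcon
    apply hx
    funext i
    fin_cases i
    · exact hcon.1
    · exact hcon.2
  have habs : |t| < 2 := by
    rw [abs_lt]
    constructor <;> nlinarith
  -- `2x₀² − 2t x₀x₁ + 2x₁² ≥ (2 − |t|)(x₀² + x₁²) > 0`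
  have hpos : 0 < x 0 ^ 2 + x 1 ^ 2 := by
    rcases h with h | h
    · have h0 : 0 < x 0 ^ 2 := by positivity
      nlinarith [sq_nonneg (x 1)]
    · have h1 : 0 < x 1 ^ 2 := by positivity
      nlinarith [sq_nonneg (x 0)]
  have h1 : 2 * |x 0 * x 1| ≤ x 0 ^ 2 + x 1 ^ 2 := by
    have h2 := two_mul_le_add_sq (|x 0|) (|x 1|)
    rw [sq_abs, sq_abs] at h2
    rw [abs_mul]
    linarith
  have key : |2 * t * (x 0 * x 1)| ≤ |t| * (x 0 ^ 2 + x 1 ^ 2) := by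
    rw [abs_mul, abs_mul, abs_two]
    nlinarith [abs_nonneg t, h1]
  have h3 := le_abs_self (2 * t * (x 0 * x 1))
  have h4 := mul_pos (show (0:ℝ) < 2 - |t| by linarith) hpos
  nlinarith [h3, key, h4]

/-- **The covariance**: `[[2,−t],[−t,2]]⁻¹ = [[2,t],[t,2]]/(4−t²)` (`t² ≠ 4`). [cite: BalabanImbrieJaffe1988, §5.13 p.305] -/
theorem inv_prec2 {t : ℝ} (ht : t ^ 2 < 4) :
    (prec2 t)⁻¹ = !![2 / (4 - t ^ 2), t / (4 - t ^ 2); t / (4 - t ^ 2), 2 / (4 - t ^ 2)] := by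
  have hdet : (4 : ℝ) - t ^ 2 ≠ 0 := by
    intro h
    linarith
  have h00 : 2 / (4 - t ^ 2) * 2 + t / (4 - t ^ 2) * -t = 1 := by
    field_simp
    ring
  have h01 : 2 / (4 - t ^ 2) * -t + t / (4 - t ^ 2) * 2 = 0 := by ring
  have h10 : t / (4 - t ^ 2) * 2 + 2 / (4 - t ^ 2) * -t = 0 := by ring
  have h11 : t / (4 - t ^ 2) * -t + 2 / (4 - t ^ 2) * 2 = 1 := by
    field_simp
    ring
  refine Matrix.inv_eq_left_inv ?_
  rw [prec2, Matrix.mul_fin_two, h00, h01, h10, h11, Matrix.one_fin_two]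

/-- The first column of the covariance: `C_s e₀ = (2, t)/(4−t²)`. [cite: BalabanImbrieJaffe1988, §5.13 p.305] -/
theorem cov_col0 {t : ℝ} (ht : t ^ 2 < 4) :
    (prec2 t)⁻¹ *ᵥ Pi.single 0 1 = ![2 / (4 - t ^ 2), t / (4 - t ^ 2)] := by
  rw [Matrix.mulVec_single_one, inv_prec2 ht]
  ext i
  fin_cases i <;> simp

/-- The second column of the covariance: `C_s e₁ = (t, 2)/(4−t²)`. [cite: BalabanImbrieJaffe1988, §5.13 p.305] -/
theorem cov_col1 {t : ℝ} (ht : t ^ 2 < 4) :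
    (prec2 t)⁻¹ *ᵥ Pi.single 1 1 = ![t / (4 - t ^ 2), 2 / (4 - t ^ 2)] := by
  rw [Matrix.mulVec_single_one, inv_prec2 ht]
  ext i
  fin_cases i <;> simp

end TwoCubes

/-! ## §3  The moments of the two-cube instance (no linear term, `t² < 4`) -/

section Moments

/-- With no linear term the source factor is `1`. [cite: BalabanImbrieJaffe1988, §5.13 p.305] -/
theorem source_zero (φ : Fin 2 → ℝ) : source (0 : Fin 2 → ℝ) φ = 1 := by
  simp [B2Eq228Conditioning.source]

/-- The partition function is positive. [cite: BalabanImbrieJaffe1988, §5.13 p.305] -/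
theorem Z_pos {t : ℝ} (ht : t ^ 2 < 4) : 0 < ∫ φ : Fin 2 → ℝ, weight (prec2 t) φ * source (0 : Fin 2 → ℝ) φ :=
  integral_weight_mul_source_pos (prec2_posDef ht) 0

/-- Every monomial in the two fields is integrable against the Gaussian weight (p13 g6 `integrable_fieldProd_tilt`).
[cite: BalabanImbrieJaffe1988, §5.13 p.305] -/
theorem integrable_prod {t : ℝ} (ht : t ^ 2 < 4) {n : ℕ} (v : Fin n → Fin 2 → ℝ) :
    Integrable fun φ : Fin 2 → ℝ => (∏ i, φ ⬝ᵥ v i) * (weight (prec2 t) φ * source (0 : Fin 2 → ℝ) φ) := by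
  refine (integrable_fieldProd_tilt (prec2_posDef ht) Finset.univ v 0).congr (Filter.Eventually.of_forall fun φ => ?_)
  dsimp only
  rw [weight_mul_source]

/-- `∫ Φ_aΦ_b dμ` is integrable. [cite: BalabanImbrieJaffe1988, §5.13 p.305] -/
theorem integrable_mono2 {t : ℝ} (ht : t ^ 2 < 4) (a b : Fin 2) :
    Integrable fun φ : Fin 2 → ℝ => φ a * φ b * (weight (prec2 t) φ * source (0 : Fin 2 → ℝ) φ) := by
  refine (integrable_prod ht ![Pi.single a 1, Pi.single b 1]).congr (Filter.Eventually.of_forall fun φ => ?_)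
  simp only [Fin.prod_univ_two, Matrix.cons_val_zero, Matrix.cons_val_one, dotProduct_single_one]

/-- `∫ Φ_aΦ_bΦ_c dμ` is integrable. [cite: BalabanImbrieJaffe1988, §5.13 p.305] -/
theorem integrable_mono3 {t : ℝ} (ht : t ^ 2 < 4) (a b c : Fin 2) :
    Integrable fun φ : Fin 2 → ℝ => φ a * φ b * φ c * (weight (prec2 t) φ * source (0 : Fin 2 → ℝ) φ) := by
  refine (integrable_prod ht ![Pi.single a 1, Pi.single b 1, Pi.single c 1]).congr
    (Filter.Eventually.of_forall fun φ => ?_)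
  simp only [Fin.prod_univ_three, Matrix.cons_val_zero, Matrix.cons_val_one, Matrix.cons_val_two, Matrix.head_cons,
    Matrix.tail_cons, dotProduct_single_one]

/-- `∫ Φ_aΦ_bΦ_cΦ_d dμ` is integrable. [cite: BalabanImbrieJaffe1988, §5.13 p.305] -/
theorem integrable_mono4 {t : ℝ} (ht : t ^ 2 < 4) (a b c d : Fin 2) :
    Integrable fun φ : Fin 2 → ℝ => φ a * φ b * φ c * φ d * (weight (prec2 t) φ * source (0 : Fin 2 → ℝ) φ) := by
  refine (integrable_prod ht ![Pi.single a 1, Pi.single b 1, Pi.single c 1, Pi.single d 1]).congr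
    (Filter.Eventually.of_forall fun φ => ?_)
  simp only [Fin.prod_univ_four, Matrix.cons_val_zero, Matrix.cons_val_one, Matrix.cons_val_two,
    Matrix.cons_val_three, Matrix.head_cons, Matrix.tail_cons, dotProduct_single_one]

/-- **Second moments** `∫Φ_aΦ_b dμ = C_{ab}·Z` (p13 g6 `pair_vacuum`; no linear term). [cite: BalabanImbrieJaffe1988, §5.13 p.305] -/
theorem moment2 {t : ℝ} (ht : t ^ 2 < 4) (a b : Fin 2) :
    ∫ φ : Fin 2 → ℝ, φ a * φ b * (weight (prec2 t) φ * source (0 : Fin 2 → ℝ) φ)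
      = (((prec2 t)⁻¹ *ᵥ Pi.single a 1) ⬝ᵥ Pi.single b 1)
          * ∫ φ : Fin 2 → ℝ, weight (prec2 t) φ * source (0 : Fin 2 → ℝ) φ := by
  have h := pair_vacuum _ (prec2_posDef ht) 0 (Pi.single a 1) (Pi.single b 1)
  simp only [dotProduct_zero, mul_zero, add_zero, dotProduct_single_one] at h
  rw [dotProduct_single_one]
  exact h

/-- `∫Φ₀Φ₁ dμ = t/(4−t²)·Z`. [cite: BalabanImbrieJaffe1988, §5.13 p.305] -/
theorem moment11 {t : ℝ} (ht : t ^ 2 < 4) :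
    ∫ φ : Fin 2 → ℝ, φ 0 * φ 1 * (weight (prec2 t) φ * source (0 : Fin 2 → ℝ) φ)
      = t / (4 - t ^ 2) * ∫ φ : Fin 2 → ℝ, weight (prec2 t) φ * source (0 : Fin 2 → ℝ) φ := by
  rw [moment2 ht, cov_col0 ht]
  simp

/-- `∫Φ₁² dμ = 2/(4−t²)·Z`. [cite: BalabanImbrieJaffe1988, §5.13 p.305] -/
theorem moment_sq1 {t : ℝ} (ht : t ^ 2 < 4) :
    ∫ φ : Fin 2 → ℝ, φ 1 * φ 1 * (weight (prec2 t) φ * source (0 : Fin 2 → ℝ) φ)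
      = 2 / (4 - t ^ 2) * ∫ φ : Fin 2 → ℝ, weight (prec2 t) φ * source (0 : Fin 2 → ℝ) φ := by
  rw [moment2 ht, cov_col1 ht]
  simp

/-- The derivative of the cubic insertion `Φ ↦ Φ₀Φ₁²`: `u ↦ u₀Φ₁² + 2Φ₀Φ₁u₁`. [cite: BalabanImbrieJaffe1988, §5.13 p.305] -/
theorem hasFDerivAt_cubic (φ : Fin 2 → ℝ) : ∃ D : (Fin 2 → ℝ) →L[ℝ] ℝ,
    HasFDerivAt (fun ψ : Fin 2 → ℝ => ψ 0 * (ψ 1 * ψ 1)) D φ ∧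
      ∀ u, D u = u 0 * (φ 1 * φ 1) + φ 0 * (2 * φ 1 * u 1) := by
  have h0 : HasFDerivAt (fun ψ : Fin 2 → ℝ => ψ 0) (ContinuousLinearMap.proj 0) φ := hasFDerivAt_apply (𝕜 := ℝ) 0 φ
  have h1 : HasFDerivAt (fun ψ : Fin 2 → ℝ => ψ 1) (ContinuousLinearMap.proj 1) φ := hasFDerivAt_apply (𝕜 := ℝ) 1 φ
  refine ⟨_, h0.mul (h1.mul h1), fun u => ?_⟩
  simp only [_root_.add_apply, _root_.smul_apply, ContinuousLinearMap.proj_apply, smul_eq_mul]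
  ring

/-- **Fourth moment** `∫Φ₀²Φ₁² dμ = (C₀₀C₁₁ + 2C₀₁²)·Z = (4+2t²)/(4−t²)²·Z` — one integration by parts (p13 g6
`ibp_source_of_integrable`, the field `Φ₀` against `Φ₀Φ₁²`) and two vacuum pairs. [cite: BalabanImbrieJaffe1988, §5.13 p.305] -/
theorem moment22 {t : ℝ} (ht : t ^ 2 < 4) :
    ∫ φ : Fin 2 → ℝ, φ 0 * φ 0 * (φ 1 * φ 1) * (weight (prec2 t) φ * source (0 : Fin 2 → ℝ) φ)
      = (4 + 2 * t ^ 2) / (4 - t ^ 2) ^ 2 * ∫ φ : Fin 2 → ℝ, weight (prec2 t) φ * source (0 : Fin 2 → ℝ) φ := by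
  have hA := prec2_posDef ht
  have hdet : (4 : ℝ) - t ^ 2 ≠ 0 := by
    intro h
    linarith
  -- the cubic insertion and its derivative along `C_s e₀ = (2,t)/(4−t²)`
  have hGd : ∀ φ : Fin 2 → ℝ, DifferentiableAt ℝ (fun ψ : Fin 2 → ℝ => ψ 0 * (ψ 1 * ψ 1)) φ := fun φ => by
    obtain ⟨D, hD, -⟩ := hasFDerivAt_cubic φ
    exact hD.differentiableAt
  have hfd : ∀ φ : Fin 2 → ℝ, fderiv ℝ (fun ψ : Fin 2 → ℝ => ψ 0 * (ψ 1 * ψ 1)) φ ((prec2 t)⁻¹ *ᵥ Pi.single 0 1)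
      = 2 / (4 - t ^ 2) * (φ 1 * φ 1) + 2 * (t / (4 - t ^ 2)) * (φ 0 * φ 1) := fun φ => by
    obtain ⟨D, hD, hDu⟩ := hasFDerivAt_cubic φ
    rw [hD.fderiv, hDu, cov_col0 ht]
    simp only [Matrix.cons_val_zero, Matrix.cons_val_one]
    ring
  -- the three integrabilities of `ibp_source_of_integrable`
  have i1 : Integrable fun φ : Fin 2 → ℝ =>
      (φ ⬝ᵥ Pi.single 0 1) * (φ 0 * (φ 1 * φ 1)) * (weight (prec2 t) φ * source (0 : Fin 2 → ℝ) φ) := by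
    refine (integrable_mono4 ht 0 0 1 1).congr (Filter.Eventually.of_forall fun φ => ?_)
    dsimp only
    rw [dotProduct_single_one]
    ring
  have i2 : Integrable fun φ : Fin 2 → ℝ =>
      fderiv ℝ (fun ψ : Fin 2 → ℝ => ψ 0 * (ψ 1 * ψ 1)) φ ((prec2 t)⁻¹ *ᵥ Pi.single 0 1)
        * (weight (prec2 t) φ * source (0 : Fin 2 → ℝ) φ) := by
    refine (((integrable_mono2 ht 1 1).const_mul (2 / (4 - t ^ 2))).add
      ((integrable_mono2 ht 0 1).const_mul (2 * (t / (4 - t ^ 2))))).congr (Filter.Eventually.of_forall fun φ => ?_)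
    simp only [Pi.add_apply, hfd φ]
    ring
  have i3 : Integrable fun φ : Fin 2 → ℝ =>
      (φ 0 * (φ 1 * φ 1)) * (weight (prec2 t) φ * source (0 : Fin 2 → ℝ) φ) := by
    refine (integrable_mono3 ht 0 1 1).congr (Filter.Eventually.of_forall fun φ => ?_)
    dsimp only
    ring
  have h := ibp_source_of_integrable (prec2 t) hA 0 hGd (Pi.single 0 1) i1 i2 i3
  simp only [dotProduct_zero, zero_mul, zero_add] at h
  -- assemble
  have hL : ∫ φ : Fin 2 → ℝ, φ 0 * φ 0 * (φ 1 * φ 1) * (weight (prec2 t) φ * source (0 : Fin 2 → ℝ) φ)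
      = ∫ φ : Fin 2 → ℝ, (φ ⬝ᵥ Pi.single 0 1) * (φ 0 * (φ 1 * φ 1)) * (weight (prec2 t) φ * source (0 : Fin 2 → ℝ) φ) := by
    congr 1
    funext φ
    rw [dotProduct_single_one]
    ring
  have hR : ∫ φ : Fin 2 → ℝ, fderiv ℝ (fun ψ : Fin 2 → ℝ => ψ 0 * (ψ 1 * ψ 1)) φ ((prec2 t)⁻¹ *ᵥ Pi.single 0 1)
        * (weight (prec2 t) φ * source (0 : Fin 2 → ℝ) φ)
      = 2 / (4 - t ^ 2) * (∫ φ : Fin 2 → ℝ, φ 1 * φ 1 * (weight (prec2 t) φ * source (0 : Fin 2 → ℝ) φ))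
        + 2 * (t / (4 - t ^ 2)) * (∫ φ : Fin 2 → ℝ, φ 0 * φ 1 * (weight (prec2 t) φ * source (0 : Fin 2 → ℝ) φ)) := by
    rw [← integral_const_mul, ← integral_const_mul,
      ← integral_add ((integrable_mono2 ht 1 1).const_mul _) ((integrable_mono2 ht 0 1).const_mul _)]
    congr 1
    funext φ
    rw [hfd φ]
    ring
  rw [hL, h, hR, moment_sq1 ht, moment11 ht]
  field_simp
  ring

/-- **`⟨Φ₀Φ₁⟩_s = s₀s₁/(4 − (s₀s₁)²)`** for `(s₀s₁)² < 4`. [cite: BalabanImbrieJaffe1988, §5.13 p.305] -/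
theorem expect_obs2 {s : Fin 2 → ℝ} (hs : (s 0 * s 1) ^ 2 < 4) :
    expect cube2 delta2 0 obs2 s = (s 0 * s 1) / (4 - (s 0 * s 1) ^ 2) := by
  rw [expect, interpForm_delta2]
  simp only [obs2]
  rw [moment11 hs, mul_div_assoc, div_self (Z_pos hs).ne', mul_one]

/-- The two inter-cube couplings of `delta2`: `⟨□₀Φ, Δ□₁Φ⟩ = ⟨□₁Φ, Δ□₀Φ⟩ = −Φ₀Φ₁`. [cite: BalabanImbrieJaffe1988, §5.13 p.305] -/
theorem blockPair_delta2 (φ : Fin 2 → ℝ) :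
    blockPair cube2 delta2 φ 0 1 = -(φ 0 * φ 1) ∧ blockPair cube2 delta2 φ 1 0 = -(φ 0 * φ 1) := by
  constructor <;>
    simp [blockPair, BIJ88DirichletForms305.boxProj, delta2, Matrix.mulVec, dotProduct, Matrix.diagonal, mul_comm]

/-- **The printed vertex of the pairing `{{0,1}}` is `V_{01} = ⟨□₀Φ, Δ_print□₁Φ⟩ = Φ₀Φ₁`.** [cite: BalabanImbrieJaffe1988, §5.13 p.305] -/
theorem pairVertex_01 : pairVertex cube2 delta2 {0, 1} = obs2 := by
  funext φ
  have e0 : ({0, 1} : Finset (Fin 2)).erase 0 = {1} := by decide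
  have e1 : ({0, 1} : Finset (Fin 2)).erase 1 = {0} := by decide
  rw [pairVertex, sum_pair (by decide : (0 : Fin 2) ≠ 1), e0, e1, sum_singleton, sum_singleton,
    (blockPair_delta2 φ).1, (blockPair_delta2 φ).2, obs2]
  ring

/-- **The printed `Γ = {0,1}` integrand**: `Σ_{pairings of {0,1}} ⟨Π[V;] Φ₀Φ₁⟩_s = ⟨Φ₀²Φ₁²⟩_s − ⟨Φ₀Φ₁⟩_s² = (4+t²)/(4−t²)²`,
`t = s₀s₁`, `(s₀s₁)² < 4`. [cite: BalabanImbrieJaffe1988, §5.13 p.305] -/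
theorem pairingD_obs2_pair {s : Fin 2 → ℝ} (hs : (s 0 * s 1) ^ 2 < 4) :
    pairingD cube2 delta2 0 obs2 {0, 1} s = (4 + (s 0 * s 1) ^ 2) / (4 - (s 0 * s 1) ^ 2) ^ 2 := by
  have hA : (interpForm cube2 delta2 s).PosDef := by
    rw [interpForm_delta2]
    exact prec2_posDef hs
  have hZ := Z_pos hs
  have hdet : (4 : ℝ) - (s 0 * s 1) ^ 2 ≠ 0 := by
    intro h
    linarith
  rw [pairingD_pair _ _ _ _ (by decide : (0 : Fin 2) ≠ 1), truncTerm_single _ _ _ _ _ hA, pairVertex_01,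
    expect_obs2 hs]
  have h4 : expect cube2 delta2 0 (fun φ => obs2 φ * obs2 φ) s = (4 + 2 * (s 0 * s 1) ^ 2) / (4 - (s 0 * s 1) ^ 2) ^ 2 := by
    rw [expect, interpForm_delta2]
    have e : (fun φ : Fin 2 → ℝ => obs2 φ * obs2 φ * (weight (prec2 (s 0 * s 1)) φ * source (0 : Fin 2 → ℝ) φ))
        = fun φ => φ 0 * φ 0 * (φ 1 * φ 1) * (weight (prec2 (s 0 * s 1)) φ * source (0 : Fin 2 → ℝ) φ) := by
      funext φ
      simp only [obs2]
      ring
    rw [e, moment22 hs, mul_div_assoc, div_self hZ.ne', mul_one]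
  rw [h4]
  field_simp
  ring

end Moments

/-! ## §4  The integrals; the printed display fails -/

section Integrals

/-- **The inner integral**: `∫₀¹ (4 + a²u²)/(4 − a²u²)² du = 1/(4 − a²)` for `a² ≤ 1` (antiderivative `u/(4 − a²u²)`).
[cite: BalabanImbrieJaffe1988, §5.13 p.305] -/
theorem inner_integral {a : ℝ} (ha : a ^ 2 ≤ 1) :
    ∫ u in (0:ℝ)..1, (4 + (a * u) ^ 2) / (4 - (a * u) ^ 2) ^ 2 = 1 / (4 - a ^ 2) := by
  have hden : ∀ u ∈ Set.uIcc (0:ℝ) 1, (4 : ℝ) - (a * u) ^ 2 ≠ 0 := by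
    intro u hu
    rw [Set.uIcc_of_le zero_le_one] at hu
    have hu2 : u ^ 2 ≤ 1 := by nlinarith [hu.1, hu.2]
    have : (a * u) ^ 2 ≤ 1 := by
      rw [mul_pow]
      nlinarith [sq_nonneg a, sq_nonneg u]
    intro h
    linarith
  have hderiv : ∀ u ∈ Set.uIcc (0:ℝ) 1,
      HasDerivAt (fun u : ℝ => u / (4 - a ^ 2 * (u * u))) ((4 + (a * u) ^ 2) / (4 - (a * u) ^ 2) ^ 2) u := by
    intro u hu
    have hden' : (4 : ℝ) - a ^ 2 * (u * u) ≠ 0 := by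
      rw [show a ^ 2 * (u * u) = (a * u) ^ 2 by ring]
      exact hden u hu
    have h1 : HasDerivAt (fun u : ℝ => u) 1 u := hasDerivAt_id u
    have h2 : HasDerivAt (fun u : ℝ => 4 - a ^ 2 * (u * u)) (0 - a ^ 2 * (1 * u + u * 1)) u :=
      (hasDerivAt_const u 4).sub (((hasDerivAt_id u).mul (hasDerivAt_id u)).const_mul (a ^ 2))
    refine (h1.div h2 hden').congr_deriv ?_
    rw [show (a * u) ^ 2 = a ^ 2 * (u * u) by ring]
    congr 1
    ring
  have hcont : ContinuousOn (fun u : ℝ => (4 + (a * u) ^ 2) / (4 - (a * u) ^ 2) ^ 2) (Set.uIcc (0:ℝ) 1) := by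
    refine ContinuousOn.div (by fun_prop) (by fun_prop) fun u hu => ?_
    exact pow_ne_zero 2 (hden u hu)
  rw [intervalIntegral.integral_eq_sub_of_hasDerivAt hderiv (hcont.intervalIntegrable)]
  norm_num

/-- **The outer integral**: `∫₀¹ da/(4 − a²) = (log 3)/4` (antiderivative `¼(log(2+a) − log(2−a))`).
[cite: BalabanImbrieJaffe1988, §5.13 p.305] -/
theorem outer_integral : ∫ a in (0:ℝ)..1, 1 / (4 - a ^ 2) = Real.log 3 / 4 := by
  have hp : ∀ a ∈ Set.uIcc (0:ℝ) 1, (0 : ℝ) < 2 + a ∧ (0 : ℝ) < 2 - a := by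
    intro a ha
    rw [Set.uIcc_of_le zero_le_one] at ha
    constructor <;> linarith [ha.1, ha.2]
  have hderiv : ∀ a ∈ Set.uIcc (0:ℝ) 1,
      HasDerivAt (fun a : ℝ => (1/4 : ℝ) * (Real.log (2 + a) - Real.log (2 - a))) (1 / (4 - a ^ 2)) a := by
    intro a ha
    obtain ⟨h1, h2⟩ := hp a ha
    have d1 : HasDerivAt (fun a : ℝ => Real.log (2 + a)) (1 / (2 + a)) a :=
      ((hasDerivAt_id a).const_add 2).log h1.ne'
    have d2 : HasDerivAt (fun a : ℝ => Real.log (2 - a)) (-1 / (2 - a)) a :=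
      ((hasDerivAt_id a).const_sub 2).log h2.ne'
    have d := (d1.sub d2).const_mul (1/4 : ℝ)
    have h3 : (4 : ℝ) - a ^ 2 ≠ 0 := by nlinarith
    have key : (1:ℝ) / 4 * (1 / (2 + a) - -1 / (2 - a)) = 1 / (4 - a ^ 2) := by
      field_simp
      ring
    rw [← key]
    exact d
  have hcont : ContinuousOn (fun a : ℝ => 1 / (4 - a ^ 2)) (Set.uIcc (0:ℝ) 1) := by
    refine ContinuousOn.div (by fun_prop) (by fun_prop) fun a ha => ?_
    obtain ⟨h1, h2⟩ := hp a ha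
    nlinarith
  rw [intervalIntegral.integral_eq_sub_of_hasDerivAt hderiv (hcont.intervalIntegrable)]
  norm_num
  ring

/-- At the corner `s = (1,1)`: `⟨Φ₀Φ₁⟩_1 = 1/3`. [cite: BalabanImbrieJaffe1988, §5.13 p.305] -/
theorem expect_obs2_one : expect cube2 delta2 0 obs2 (fun _ => 1) = 1 / 3 := by
  rw [expect_obs2 (by norm_num)]
  norm_num

/-- At the corner `s = (0,0)` (decoupled cubes): `⟨Φ₀Φ₁⟩_0 = 0`. [cite: BalabanImbrieJaffe1988, §5.13 p.305] -/
theorem expect_obs2_zero : expect cube2 delta2 0 obs2 0 = 0 := by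
  rw [expect_obs2 (by norm_num)]
  norm_num

/-- The evaluation point `⟨·⟩_1` of the coordinate list `[0,1]` is `s = (1,1)`. [cite: BalabanImbrieJaffe1988, §5.13 p.305] -/
theorem onePt_two : onePt [(0 : Fin 2), 1] (0 : Fin 2 → ℝ) = fun _ => 1 := by
  funext i
  fin_cases i <;> simp [onePt]

/-- **The printed right-hand side evaluates to `(log 3)/4`**:
`Σ_{Γ⊂{0,1}} ∫ds_Γ Σ_{pairings of Γ} ⟨Π[V;] Φ₀Φ₁⟩_{s_Γ} = ⟨Φ₀Φ₁⟩_0 + 0 + 0 + ∫₀¹∫₀¹ (4+s₀²s₁²)/(4−s₀²s₁²)² ds₁ds₀ = (log 3)/4`.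
[cite: BalabanImbrieJaffe1988, §5.13 p.305] -/
theorem expansionSum_pairingD_obs2 :
    expansionSum [(0 : Fin 2), 1] (pairingD cube2 delta2 0 obs2) 0 = Real.log 3 / 4 := by
  have h01 : ([(0 : Fin 2), 1] : List (Fin 2)).toFinset = {0, 1} := by decide
  have h0 : ([(0 : Fin 2)] : List (Fin 2)).toFinset = {0} := by decide
  have h1 : ([(1 : Fin 2)] : List (Fin 2)).toFinset = {1} := by decide
  simp only [expansionSum, List.sublists'_cons, List.sublists'_nil, List.map_cons, List.map_nil, List.cons_append,
    List.nil_append, List.sum_cons, List.sum_nil, iterInt, List.toFinset_nil, h01,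
    h0, h1, pairingD_empty, pairingD_singleton, expect_obs2_zero, intervalIntegral.integral_zero, add_zero, zero_add]
  -- the `Γ = {0,1}` term: substitute the closed form on the unit square, then integrate twice
  have hinner : ∀ a ∈ Set.uIcc (0:ℝ) 1,
      (∫ u in (0:ℝ)..1, pairingD cube2 delta2 0 obs2 {0, 1} (update (update (0 : Fin 2 → ℝ) 0 a) 1 u))
        = 1 / (4 - a ^ 2) := by
    intro a ha
    rw [Set.uIcc_of_le zero_le_one] at ha
    have ha2 : a ^ 2 ≤ 1 := by nlinarith [ha.1, ha.2]
    rw [← inner_integral ha2]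
    refine intervalIntegral.integral_congr fun u hu => ?_
    rw [Set.uIcc_of_le zero_le_one] at hu
    have hu2 : u ^ 2 ≤ 1 := by nlinarith [hu.1, hu.2]
    have hs0 : update (update (0 : Fin 2 → ℝ) 0 a) 1 u 0 = a := by simp
    have hs1 : update (update (0 : Fin 2 → ℝ) 0 a) 1 u 1 = u := by simp
    have hlt : (a * u) ^ 2 < 4 := by
      rw [mul_pow]
      nlinarith [sq_nonneg a, sq_nonneg u]
    rw [pairingD_obs2_pair (by rw [hs0, hs1]; exact hlt), hs0, hs1]
  rw [intervalIntegral.integral_congr hinner, outer_integral]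

/-- `log 3 < 4/3` (`e^{4/3} = (e^{1/3})⁴ ≥ (4/3)⁴ = 256/81 > 3`). [folklore] -/
private theorem log_three_lt : Real.log 3 < 4 / 3 := by
  rw [Real.log_lt_iff_lt_exp (by norm_num : (0:ℝ) < 3)]
  have h1 : (4:ℝ) / 3 ≤ Real.exp (1 / 3) := by
    have := Real.add_one_le_exp (1 / 3 : ℝ)
    linarith
  have h2 : Real.exp (4 / 3 : ℝ) = Real.exp (1 / 3) ^ 4 := by
    rw [← Real.exp_nat_mul]
    norm_num
  have h3 : ((4:ℝ) / 3) ^ 4 ≤ Real.exp (1 / 3) ^ 4 := by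
    gcongr
  rw [h2]
  nlinarith [h3]

/-- **THE PRINTED PAIRING DISPLAY (p. 305, "The result is …") FAILS AS PRINTED** in the two-cube instance: the left-hand
side `⟨Φ₀Φ₁⟩_1 = 1/3` differs from the printed right-hand side `Σ_{Γ⊂{0,1}}∫ds_Γ Σ_{pairings p of Γ}⟨Π_{γ∈p}[V_γ;]Φ₀Φ₁⟩_{s_Γ}
= (log 3)/4`.  (The identity `⟨·⟩_1 = Σ_Γ∫ds_Γ ∂/∂s_Γ⟨·⟩_{s_Γ}` holds — `BIJ88FTCExpansion305.ftc_expansion`; what fails is the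
evaluation of `∂/∂s_Γ⟨·⟩_{s_Γ}` by perfect matchings of `Γ` alone: at `Γ = {0,1}` the term `s₀s₁⟨[V₀₁;][V₁₀;]Φ₀Φ₁⟩_s` brought
down by the second derivative while the factor `s₁` of the first vertex survives is omitted.  The witness does not depend
on the sign convention for the vertex: with `+⟨□_iΦ,Δ□_jΦ⟩` the printed right-hand side would be `−(log 3)/4`.)
[cite: BalabanImbrieJaffe1988, §5.13 p.305] -/
theorem pairingDisplay_fails :
    expect cube2 delta2 0 obs2 (onePt [(0 : Fin 2), 1] 0)
      ≠ expansionSum [(0 : Fin 2), 1] (pairingD cube2 delta2 0 obs2) 0 := by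
  rw [onePt_two, expect_obs2_one, expansionSum_pairingD_obs2]
  have := log_three_lt
  intro h
  linarith

end Integrals

end Literature.MathematicalPhysics.QuantumFieldTheory.BalabanImbrieJaffe1984to88.BIJ88PairingDisplay305
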